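import Summits.QuantumFields.BalabanUV.T4Continuum.Support.NE3EnergyWeightedCovShape
import Summits.QuantumFields.BalabanUV.T4Continuum.Support.NE7EtaCurlFromCovGradient

/-!
# T⁴ programme, node NE3 — SPINE INDEX: THE COVARIANT ROOT `NE3EnergyRateWCov` IS NE3's STATEMENT OF RECORD FOR THE LADDER — the NE7 consumer's
# END follows from the NAMED root at `d = 4` by definitional unfolding, and the root projects to the row's base shape T-E_w

Cell `pub-balaban-gaps` (YM blitz, track G2, seat `ne3`; writer prover-pub-balaban-gaps-ne3-g0-0, 2026-08-22), repair R7 of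
`run/shared/lean/pub/pub-balaban-gaps/ne/NE3.md` (the BALABAN-GAPS.md row NE3 names ONE Lean statement; this module certifies by elaboration that the named
statement is what the downstream consumer reads).  Inputs BY NAME: `NE3EnergyWeightedCovShape.NE3EnergyRateWCov` (the covariant root, typed per
INTERFACE REQUEST NE7→NE3 amendment 4 = pub-balaban WAKE-1), `NE7EtaCurlFromCovGradient.closeness_of_covRoot₂` (p254713; the consumer-side END of NE7
route #1's background coordinate: (P) `‖Z‖ ≤ 8l₁²γ·θ^{8k}`, (Gᶜ)∕(C) `θ^{13k}`, (Q) plaquette closeness `θ^{13k}`, `θ⁶ = L⁻¹`).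

WHAT (all `[bookkeeping]`, one-line applications of landed theorems BY NAME):
* `closeness_of_ne3EnergyRateWCov` — `closeness_of_covRoot₂` with its hypothesis `h` supplied by `hcov : NE3EnergyRateWCov 4 𝒞 L N b g C Λ₁ Λ₂' dom`
  (no adapter: the shape IS the hypothesis, token for token);
* `ne3EnergyRateW_of_covRoot` — the root projects to the base shape `NE3EnergyWeightedShapes.NE3EnergyRateW` (re-export of
  `NE3EnergyWeightedCovShape.ne3EnergyRateW_of_cov`, so that importers of this index see both faces).
THE THREE FACES OF NE3's LOCAL HALF and what each END leaves open (records, by name; nothing here is proved about them):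
T-E_w `NE3EnergyRateW` ⊂ T-E_w♯ `NE3EnergyWeightedSupShape.NE3EnergyRateWSup` (+ decaying sup; END of record over `sfClass`:
`NE3EnergyRateWSupRoutePiRInv.ne3EnergyRateWSup_sfClass_routePi_rinv` p247216, joined form `NE3EnergyRateWSupRoutePiFinal.ne3EnergyRateWSup_sfClass_routePi_final`
— CONDITIONAL on the per-pair leaf `hleaves` + k-free numerics) and T-E_w^cov `NE3EnergyRateWCov` (+ (Lip₁ᶜ)(Lip₂′ᶜ); NO END in the tree: its proof is
pub-balaban's NEEDS-COORDINATOR #1, un-seated).  Reading (A): `MinimalActionThm1Type.actionRate_sfClass_thm1Type` ⇐ (H∃) alone.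

HONEST FRAMING.  Index only: `NE3EnergyRateWCov 4 (sfClass 4 L N ε) …` for Bałaban's minimisers is a HYPOTHESIS (row NE3's spine estimate, re-typed,
covariant) — NOT PRINTED ([Balaban1985RegularSpaces] Thm 2 (1.36)∕(1.39) pp. 82–83 and [Balaban1985Variational] Thm 1 (9)–(10) p. 279 print the
regular-gauge TYPE of its two Lipschitz conjuncts; the energy conjunct with a rate is printed nowhere) and NOT PROVED; every theorem below is an
implication from it.  NE3 and NE7 NOT proved; spine PROVED 0∕9; finite T⁴ rung (B)+1 — NOT infinite volume, NOT mass gap, NOT `BetaPertH`, NOT Clay.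
HONEST DEPENDENCY: continuum YM on T⁴ ⇐ BetaPertH ∧ nine spine estimates (0/9 proved); BetaPertH ⇐ (D1) ∧ (D4) ∧ CAP+tail; G-an2-4 gates asym, D1
and NE2/3/4.  PLACEMENT: `Summits/QuantumFields/BalabanUV/T4Continuum/Spine/NE3/`.
-/

set_option autoImplicit false

open scoped BigOperators Matrix Matrix.Norms.L2Operator
open Finset

namespace Summit.QuantumFields.BalabanUV.T4Continuum.NE3.CovariantRoot

open Literature.MathematicalPhysics.QuantumFieldTheory.Balaban1983to89
open B7Prop1Explicit B7Prop2Explicit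
open T4AveragingDeficitWall hiding Site Plane Plaq Bond
open T4AveragingDeficitWallBoundary (IsPeriodicCfg periodBox)
open AveragingDeficitPeriodicCounting (IsPeriodicDir)
open AveragingDeficitDualResidual (dualC1 dualC2)
open AveragingDeficitDerivWallProof (wallConst)
open MinimalActionSandwich (IsMinimiser)
open MinimalActionRate (Regular)
open NE3EnergyShapes (IsUnitarySite IsPeriodicSite)
open NE3EnergyWeightedShapes (NE3EnergyRateW)
open NE3EnergyWeightedCovShape (NE3EnergyRateWCov ne3EnergyRateW_of_cov)

noncomputable section

variable {n : Type*} [Fintype n] [DecidableEq n]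

/-! ## §1 The consumer-side END of NE7 route #1 from the NAMED root -/

/-- **NE7's CONSUMER END FROM THE NAMED NE3 ROOT** (`d = 4`): `NE7EtaCurlFromCovGradient.closeness_of_covRoot₂` with `h := hcov`,
`hcov : NE3EnergyRateWCov 4 𝒞 L N b g C Λ₁ Λ₂' dom` — per level `k ≥ 1` under the fit `γ(θ^k)² ≤ l₁N`, for every datum and minimiser pair: the gauge `u`,
the discrepancy direction `Z` with the representation `gaugeAct u UA = vary W Z 1` and the four geometric closeness rates (P) `θ^{8k}`, (Gᶜ)∕(C)∕(Q)
`θ^{13k}` (`θ⁶ = L⁻¹`).  The shape is the hypothesis token for token; nothing is adapted. [folklore] -/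
theorem closeness_of_ne3EnergyRateWCov [Nonempty n] {𝒞 : ℕ → Set (Site 4 → Fin 4 → (Matrix n n ℂ)ˣ)} {L N : ℕ} (hL : 2 ≤ L)
    (hN : 1 ≤ N) {θ : ℝ} (hθ : 0 < θ) (hθ6 : θ ^ 6 = ((L : ℝ))⁻¹) {b g C Λ₁ Λ₂' : ℝ} (hb : 0 ≤ b)
    (hbs : 512 * (4 + 1) * (4 + 4) * (L : ℝ) ^ 2 * b ≤ 1) (hg : 0 ≤ g) (hC : 0 ≤ C) (hΛ₂' : 0 < Λ₂')
    {dom : Set (Site 4 → Fin 4 → (Matrix n n ℂ)ˣ)}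
    (hcov : NE3EnergyRateWCov 4 𝒞 L N b g C Λ₁ Λ₂' dom)
    {γ l₁ : ℝ} (hγ : 0 < γ)
    (hγ3 : C * (wallConst 4 L * (N : ℝ) ^ 2 * (Real.sqrt g * dualC2 4 L + 2 * b ^ 2 * dualC1 4 L)) ≤ γ ^ 3)
    (hl₁ : 0 < l₁) (hΛl₁ : Λ₁ ≤ l₁ ^ 3)
    {k : ℕ} (hk : 1 ≤ k) (hfit : γ * (θ ^ k) ^ 2 ≤ l₁ * N)
    {V : Site 4 → Fin 4 → (Matrix n n ℂ)ˣ} (hV : V ∈ dom) {UA UB : Site 4 → Fin 4 → (Matrix n n ℂ)ˣ}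
    (hA : IsMinimiser 4 𝒞 L N k V UA) (hB : IsMinimiser 4 𝒞 L N (k + 1) V UB) (hreg : Regular 4 L N b g (k + 1) UB) :
    ∃ (u : Site 4 → (Matrix n n ℂ)ˣ) (Z : Site 4 → Fin 4 → Matrix n n ℂ),
      IsUnitarySite u ∧ IsPeriodicSite u ((N * L ^ k : ℕ) : ℤ) ∧ IsSkewDir Z ∧ IsPeriodicDir Z ((N * L ^ k : ℕ) : ℤ) ∧
      gaugeAct u UA = vary (rescale L (bavg L UB)) Z 1 ∧
      (∀ (x : Site 4) (κ : Fin 4), ‖Z x κ‖ ≤ 8 * l₁ ^ 2 * γ * θ ^ (8 * k)) ∧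
      (∀ (x : Site 4) (μ κ : Fin 4),
        ‖Ad (rescale L (bavg L UB) (x + e κ) μ) (Z (x + e μ) κ) - Z x κ‖ ≤ 4 * l₁ * Real.sqrt (2 * γ * Λ₂') * θ ^ (13 * k)) ∧
      (∀ (π : T4AveragingDeficitWall.Plane 4) (x : Site 4),
        ‖curl (rescale L (bavg L UB)) Z (x, π)‖ ≤ 8 * l₁ * Real.sqrt (2 * γ * Λ₂') * θ ^ (13 * k)) ∧
      (∀ (z : Site 4) (μ ν : Fin 4),
        ‖((hol (gaugeAct u UA) z (plaqWord μ ν) : (Matrix n n ℂ)ˣ) : Matrix n n ℂ)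
            - ((hol (rescale L (bavg L UB)) z (plaqWord μ ν) : (Matrix n n ℂ)ˣ) : Matrix n n ℂ)‖
          ≤ (8 * l₁ * Real.sqrt (2 * γ * Λ₂') + 1536 * l₁ ^ 4 * γ ^ 2 * Real.exp (8 * l₁ ^ 2 * γ)) * θ ^ (13 * k)) :=
  NE7EtaCurlFromCovGradient.closeness_of_covRoot₂ hL hN hθ hθ6 hb hbs hg hC hΛ₂' hcov hγ hγ3 hl₁ hΛl₁ hk hfit hV hA hB hreg

/-! ## §2 The root's base face -/

/-- **THE COVARIANT ROOT PROJECTS TO THE ROW'S BASE SHAPE T-E_w** (any `d`): `NE3EnergyRateWCov d 𝒞 L N b g C Λ₁ Λ₂' dom → NE3EnergyRateW d 𝒞 L N b g C dom`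
— re-export of `NE3EnergyWeightedCovShape.ne3EnergyRateW_of_cov` for importers of this index (every consumer of T-E_w, e.g. the crude (D) END
`NE3LocalCrudeWEnd` through T-E_w♯, reads the base face). [folklore] -/
theorem ne3EnergyRateW_of_covRoot {d : ℕ} {𝒞 : ℕ → Set (Site d → Fin d → (Matrix n n ℂ)ˣ)} {L N : ℕ} {b g C Λ₁ Λ₂' : ℝ}
    {dom : Set (Site d → Fin d → (Matrix n n ℂ)ˣ)} (hcov : NE3EnergyRateWCov d 𝒞 L N b g C Λ₁ Λ₂' dom) :
    NE3EnergyRateW d 𝒞 L N b g C dom :=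
  ne3EnergyRateW_of_cov hcov

end

end Summit.QuantumFields.BalabanUV.T4Continuum.NE3.CovariantRoot
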